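import Literature.NumberTheory.Irrationality.Zudilin2003.ZetaFourRecursion
import Literature.NumberTheory.Irrationality.Zudilin2003.RatesProofs
import Literature.Analysis.Asymptotics.PoincareRatioTheorem
import HarnessLib

/-!
# Zudilin 2003 (JTNB), §2: the rates of the `ζ(4)` recursion — `coeff_asymptotics` PROVED, `form_asymptotics` from (7)

Topic `Literature/NumberTheory/Irrationality/Zudilin2003`, sub-namespace `ZetaFour` (objects of
`ZetaFourRecursion.lean`: the recursion (3) `(n+1)⁵u_{n+1} − b(n)u_n − 3n³(3n−1)(3n+1)u_{n−1} = 0`, its solutions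
`u = seq 1 12`, `v = seq 0 13`, the named facts `coeff_asymptotics`, `form_asymptotics`, `theorem1_limit`).
Source: W. Zudilin, *Well-poised hypergeometric service for diophantine problems of zeta values*, J. Théor.
Nombres Bordeaux **15** (2003) 593–626 [Zudilin2003WellPoised], §2, the two displays after Theorem 1, READ ON THE
PAGE (held text `paper:galaxy-pdf-1593531969313998860`, p0004): "Application of Poincaré's theorem then yields
the asymptotic relations `lim log u_n/n = lim log v_n/n = 3 log(3 + 2√3) = 5.59879212…` and (see [Zu1],
Proposition 2) `lim log|u_nζ(4) − v_n|/n = 3 log|3 − 2√3| = −2.30295525…`, since the characteristic polynomial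
`λ² − 270λ − 27` of the equation (3) has zeros `135 ± 78√3 = (3 ± 2√3)³`."

## What is proved (0 sorry, no definitions, no new named facts; net debt −1)

This is the `ζ(4)` twin of `RatesProofs.lean` (the same author's Catalan recursion, whose characteristic
polynomial `λ² − 11λ − 1` also has roots of opposite signs) and reuses its generic tools
(`Zudilin2003.casoratian_succ`, `Zudilin2003.TailSqueeze.*`, `Zudilin2003Growth.tendsto_root_of_tendsto_log_div`)
and the tree's Poincaré theorem under an a-priori bracket
(`Literature.Analysis.Asymptotics.PoincareRecurrence.tendsto_ratio_of_recurrence₂`, Elaydi Thm 7.10, with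
Lemma 7.14 `tendsto_log_abs_div_of_tendsto_ratio`). Writing (3) in solved form
`x_{m+2} = s_m x_{m+1} − t_m x_m`, `s_m = b(m+1)/(m+2)⁵ → 270`, `t_m = −3(m+1)³(3m+2)(3m+4)/(m+2)⁵ → −27`
(`tendsto_coeffS`, `tendsto_coeffT`; the coefficients are kept as explicit expressions, no definitions):

* `seq_pos_ratio` — ratio induction: a solution with `x_N > 0`, `12x_N ≤ x_{N+1}` has `x_n > 0` and
  `12x_n ≤ x_{n+1}` for all `n ≥ N` (`b(n) ≥ 12(n+1)⁵` coefficientwise and `t_m < 0`); hence `u_n > 0`,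
  `u_{n+1} ≥ 12u_n` for all `n` (`u_pos_ratio`) and `v_n > 0`, `v_{n+1} ≥ 12v_n` for `n ≥ 1` (`v_pos_ratio`);
* `tendsto_ratio_of_bracket` — Poincaré: such a solution has `x_{n+1}/x_n → 135 + 78√3 = (3 + 2√3)³`
  (contraction constant `27/12² < 1`), and `log x_n/n → log(135 + 78√3) = 3 log(3 + 2√3)`
  (`tendsto_log_div_of_bracket`, `log_lam`);
* **`coeff_asymptotics_holds : coeff_asymptotics`** — the first display: `log u_n/n → 3 log(3+2√3)` and
  `log v_n/n → 3 log(3+2√3)` (`tendsto_log_u_div`, `tendsto_log_v_div`; also `tendsto_root_u`: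
  `u_n^{1/n} → (3+2√3)³`);
* the Casoratian `W_n = u_nv_{n+1} − u_{n+1}v_n = 13·∏_{i<n} t_i` alternates, `log|W_n|/n → log 27`
  (`casoratian_succ_eq`, `casoratian_ne_zero`, `tendsto_log_abs_casoratian_div`); the steps
  `v_{n+1}/u_{n+1} − v_n/u_n = W_n/(u_nu_{n+1})` shrink geometrically with ratio `≤ 27/144 = 3/16 < 1/2`
  (`abs_step_succ_le`), so `v_n/u_n` converges (`exists_tendsto_ratio`) and, for ITS LIMIT `L`, by the
  sign-free tail squeeze: `u_nL − v_n ≠ 0` for every `n` (`form_ne_zero_of_tendsto`) and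
  `log|u_nL − v_n|/n → log 27 − log(135+78√3) = 3 log|3 − 2√3|` (`tendsto_log_abs_form_div_of_tendsto`,
  `log_decay`) — UNCONDITIONALLY, with `L` unidentified (`exists_limit_rates`);
* **`form_asymptotics_of_theorem1_limit : theorem1_limit → form_asymptotics`** — the second display follows
  from the limit relation (7) `v_n/u_n → ζ(4)` ALONE (the source's "[Zu1], Proposition 2"); (7) itself is the
  analytic content of Theorem 1 (Lemmas 1–5 of §2, the well-poised `F_n = −Σ R_n'(t)`), a cited fact of
  `ZetaFourRecursion.lean` not proved here.

HONEST FRAMING (cell zeta5-irr / pub-zeta5): instrument-level real analysis of a printed recursion; nothing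
here is an irrationality statement ("the linear forms `6D_n⁵(u_nζ(4) − v_n)` do not tend to 0"); nothing about
`ζ(5)`; no rung of the cell's ladder moves.

## References
* [Zudilin2003WellPoised] W. Zudilin, *Well-poised hypergeometric service for diophantine problems of zeta
  values*, J. Théor. Nombres Bordeaux 15 (2003) 593–626, doi:10.5802/jtnb.415, §2 (p. 596 of the journal =
  p0004 of the held preprint text).
* [Elaydi1996] S. N. Elaydi, *An Introduction to Difference Equations*, Springer (1996), Thm 7.10, Lemma 7.14
  (the tree's `PoincareRatioTheorem.lean`).
-/

noncomputable section

open Filter Topology Finset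
open scoped Nat

namespace Literature.NumberTheory.Irrationality.Zudilin2003.ZetaFour

open Literature.NumberTheory.Transcendental (zetaValue)
open Literature.Analysis.Asymptotics.PoincareRecurrence

/-! ### The recursion over `ℝ` -/

/-- (3) cleared of denominators, over `ℝ`: `(m+2)⁵x_{m+2} = b(m+1)x_{m+1} + c(m+1)x_m` for `x = seq x₀ x₁`
(`c(n) = 3n³(3n−1)(3n+1)`). [cite: Zudilin2003WellPoised, §2 eq. (3)] -/
theorem seq_cast_cleared (x₀ x₁ : ℚ) (m : ℕ) :
    ((m : ℝ) + 2) ^ 5 * (seq x₀ x₁ (m + 2) : ℝ) =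
      b ((m : ℝ) + 1) * (seq x₀ x₁ (m + 1) : ℝ) + c ((m : ℝ) + 1) * (seq x₀ x₁ m : ℝ) := by
  rw [seq]
  have hm : ((m : ℚ) + 2) ^ 5 ≠ 0 := by positivity
  have h : ((m : ℚ) + 2) ^ 5 * ((b ((m : ℚ) + 1) * seq x₀ x₁ (m + 1) + c ((m : ℚ) + 1) * seq x₀ x₁ m) /
      ((m : ℚ) + 2) ^ 5) = b ((m : ℚ) + 1) * seq x₀ x₁ (m + 1) + c ((m : ℚ) + 1) * seq x₀ x₁ m :=
    mul_div_cancel₀ _ hm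
  have h' := congrArg (fun q : ℚ => (q : ℝ)) h
  simp only [b, c] at h' ⊢
  push_cast at h' ⊢
  linear_combination h'

/-- (3) in solved form over `ℝ`: `x_{m+2} = s_m x_{m+1} − t_m x_m` with `s_m = b(m+1)/(m+2)⁵`,
`t_m = −c(m+1)/(m+2)⁵`. [cite: Zudilin2003WellPoised, §2 eq. (3)] -/
theorem seq_cast_solved (x₀ x₁ : ℚ) (m : ℕ) :
    (seq x₀ x₁ (m + 2) : ℝ) =
      b ((m : ℝ) + 1) / ((m : ℝ) + 2) ^ 5 * (seq x₀ x₁ (m + 1) : ℝ) -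
        -(c ((m : ℝ) + 1)) / ((m : ℝ) + 2) ^ 5 * (seq x₀ x₁ m : ℝ) := by
  have hm : ((m : ℝ) + 2) ^ 5 ≠ 0 := by positivity
  have h := seq_cast_cleared x₀ x₁ m
  field_simp
  linear_combination h

/-- `c(m+1) = 3(m+1)³(3m+2)(3m+4) > 0`. [cite: Zudilin2003WellPoised, §2 eq. (3)] -/
theorem c_succ_pos (m : ℕ) : 0 < c ((m : ℝ) + 1) := by
  have e : c ((m : ℝ) + 1) = 3 * ((m : ℝ) + 1) ^ 3 * (3 * m + 2) * (3 * m + 4) := by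
    unfold c; ring
  rw [e]; positivity

/-- `c(m+1) ≤ 27(m+2)⁵` (so `|t_m| ≤ 27`): the difference is a polynomial in `m` with nonnegative
coefficients. [cite: Zudilin2003WellPoised, §2 (display after Theorem 1)] -/
theorem c_succ_le (m : ℕ) : c ((m : ℝ) + 1) ≤ 27 * ((m : ℝ) + 2) ^ 5 := by
  have e : 27 * ((m : ℝ) + 2) ^ 5 - c ((m : ℝ) + 1) =
      135 * ((m : ℝ) + 1) ^ 4 + 273 * ((m : ℝ) + 1) ^ 3 + 270 * ((m : ℝ) + 1) ^ 2 +
        135 * ((m : ℝ) + 1) + 27 := by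
    unfold c; ring
  have h : 0 ≤ 135 * ((m : ℝ) + 1) ^ 4 + 273 * ((m : ℝ) + 1) ^ 3 + 270 * ((m : ℝ) + 1) ^ 2 +
      135 * ((m : ℝ) + 1) + 27 := by positivity
  linarith

/-- `b(m+1) ≥ 12(m+2)⁵` (so `s_m ≥ 12`): `b(n) − 12(n+1)⁵ = 258n⁵ + 615n⁴ + 582n³ + 258n² + 45n`.
[cite: Zudilin2003WellPoised, §2 eq. (4)] -/
theorem b_succ_ge (m : ℕ) : 12 * ((m : ℝ) + 2) ^ 5 ≤ b ((m : ℝ) + 1) := by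
  have e : b ((m : ℝ) + 1) - 12 * ((m : ℝ) + 2) ^ 5 =
      258 * ((m : ℝ) + 1) ^ 5 + 615 * ((m : ℝ) + 1) ^ 4 + 582 * ((m : ℝ) + 1) ^ 3 +
        258 * ((m : ℝ) + 1) ^ 2 + 45 * ((m : ℝ) + 1) := by
    unfold b; ring
  have h : 0 ≤ 258 * ((m : ℝ) + 1) ^ 5 + 615 * ((m : ℝ) + 1) ^ 4 + 582 * ((m : ℝ) + 1) ^ 3 +
      258 * ((m : ℝ) + 1) ^ 2 + 45 * ((m : ℝ) + 1) := by positivity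
  linarith

/-! ### Ratio induction: positivity and the a-priori bracket `x_{n+1} ≥ 12 x_n` -/

/-- **Ratio induction** for (3): if `x = seq x₀ x₁` has `x_N > 0` and `12x_N ≤ x_{N+1}`, then `x_n > 0` and
`12x_n ≤ x_{n+1}` for every `n ≥ N` (`x_{m+2} = s_m x_{m+1} + |t_m| x_m ≥ s_m x_{m+1} ≥ 12 x_{m+1}`).
[cite: Zudilin2003WellPoised, Theorem 1 ("the numbers u_n and v_n are positive rationals")] -/
theorem seq_pos_ratio (x₀ x₁ : ℚ) (N : ℕ) (h0 : 0 < (seq x₀ x₁ N : ℝ))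
    (h1 : 12 * (seq x₀ x₁ N : ℝ) ≤ (seq x₀ x₁ (N + 1) : ℝ)) :
    ∀ n, N ≤ n → 0 < (seq x₀ x₁ n : ℝ) ∧ 12 * (seq x₀ x₁ n : ℝ) ≤ (seq x₀ x₁ (n + 1) : ℝ) := by
  refine Nat.le_induction ⟨h0, h1⟩ fun n hn ih => ?_
  obtain ⟨hpos, hle⟩ := ih
  have hpos1 : 0 < (seq x₀ x₁ (n + 1) : ℝ) := by linarith
  refine ⟨hpos1, ?_⟩
  have hcl := seq_cast_cleared x₀ x₁ n
  have hb := b_succ_ge n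
  have hc := (c_succ_pos n).le
  have hm : (0 : ℝ) < ((n : ℝ) + 2) ^ 5 := by positivity
  -- `(n+2)⁵ x_{n+2} ≥ b(n+1) x_{n+1} ≥ 12 (n+2)⁵ x_{n+1}`
  have h2 : 12 * ((n : ℝ) + 2) ^ 5 * (seq x₀ x₁ (n + 1) : ℝ) ≤
      ((n : ℝ) + 2) ^ 5 * (seq x₀ x₁ (n + 1 + 1) : ℝ) := by
    rw [show n + 1 + 1 = n + 2 by ring, hcl]
    nlinarith [mul_nonneg hc hpos.le]
  nlinarith

/-- `u_n > 0` and `u_{n+1} ≥ 12u_n` for all `n` (`u₀ = 1`, `u₁ = 12`).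
[cite: Zudilin2003WellPoised, Theorem 1 and eq. (5)] -/
theorem u_pos_ratio (n : ℕ) : 0 < (u n : ℝ) ∧ 12 * (u n : ℝ) ≤ (u (n + 1) : ℝ) := by
  refine seq_pos_ratio 1 12 0 ?_ ?_ n (Nat.zero_le n)
  · simp [seq]
  · simp [seq]

/-- `v_n > 0` and `v_{n+1} ≥ 12v_n` for `n ≥ 1` (`v₁ = 13`, `v₂ = 13923/16`; `v₀ = 0`).
[cite: Zudilin2003WellPoised, Theorem 1 and eq. (5)] -/
theorem v_pos_ratio (n : ℕ) (hn : 1 ≤ n) : 0 < (v n : ℝ) ∧ 12 * (v n : ℝ) ≤ (v (n + 1) : ℝ) := by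
  refine seq_pos_ratio 0 13 1 ?_ ?_ n hn
  · simp [seq]
  · have h2 : seq 0 13 (1 + 1) = 13923 / 16 := v_two
    rw [h2]
    simp [seq]
    norm_num

/-! ### The coefficients of the solved form tend to `270` and `−27` -/

/-- `1/(m+2) → 0`. [folklore] -/
private theorem tendsto_inv_add_two : Tendsto (fun m : ℕ => 1 / ((m : ℝ) + 2)) atTop (𝓝 0) :=
  tendsto_const_nhds.div_atTop (tendsto_natCast_atTop_atTop.atTop_add tendsto_const_nhds)

/-- **`s_m = b(m+1)/(m+2)⁵ → 270`** (leading coefficient of (4)).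
[cite: Zudilin2003WellPoised, §2 (display after Theorem 1: characteristic polynomial λ² − 270λ − 27)] -/
theorem tendsto_coeffS :
    Tendsto (fun m : ℕ => b ((m : ℝ) + 1) / ((m : ℝ) + 2) ^ 5) atTop (𝓝 270) := by
  set F : ℝ → ℝ := fun y => 270 * (1 - y) ^ 5 + 675 * y * (1 - y) ^ 4 + 702 * y ^ 2 * (1 - y) ^ 3 +
      378 * y ^ 3 * (1 - y) ^ 2 + 105 * y ^ 4 * (1 - y) + 12 * y ^ 5 with hF
  have hseq : ∀ m : ℕ, b ((m : ℝ) + 1) / ((m : ℝ) + 2) ^ 5 = F (1 / ((m : ℝ) + 2)) := by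
    intro m
    have hm : (m : ℝ) + 2 ≠ 0 := by positivity
    rw [hF]
    unfold b
    field_simp
    ring
  have hFc : Continuous F := by rw [hF]; fun_prop
  have hF0 : Tendsto (fun m : ℕ => F (1 / ((m : ℝ) + 2))) atTop (𝓝 (F 0)) :=
    (hFc.tendsto 0).comp tendsto_inv_add_two
  have hval : F 0 = 270 := by rw [hF]; norm_num
  rw [← hval]
  exact hF0.congr fun m => (hseq m).symm

/-- **`t_m = −c(m+1)/(m+2)⁵ → −27`** (leading coefficient `27` of `3n³(3n−1)(3n+1)`).
[cite: Zudilin2003WellPoised, §2 (display after Theorem 1: characteristic polynomial λ² − 270λ − 27)] -/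
theorem tendsto_coeffT :
    Tendsto (fun m : ℕ => -(c ((m : ℝ) + 1)) / ((m : ℝ) + 2) ^ 5) atTop (𝓝 (-27)) := by
  set F : ℝ → ℝ := fun y => -(3 * (1 - y) ^ 3 * (3 - 4 * y) * (3 - 2 * y)) with hF
  have hseq : ∀ m : ℕ, -(c ((m : ℝ) + 1)) / ((m : ℝ) + 2) ^ 5 = F (1 / ((m : ℝ) + 2)) := by
    intro m
    have hm : (m : ℝ) + 2 ≠ 0 := by positivity
    rw [hF]
    unfold c
    field_simp
    ring
  have hFc : Continuous F := by rw [hF]; fun_prop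
  have hF0 : Tendsto (fun m : ℕ => F (1 / ((m : ℝ) + 2))) atTop (𝓝 (F 0)) :=
    (hFc.tendsto 0).comp tendsto_inv_add_two
  have hval : F 0 = -27 := by rw [hF]; norm_num
  rw [← hval]
  exact hF0.congr fun m => (hseq m).symm

/-! ### The dominant root `135 + 78√3 = (3 + 2√3)³` -/

/-- `√3² = 3`. [folklore] -/
private theorem sqrt_three_sq : Real.sqrt 3 ^ 2 = 3 := Real.sq_sqrt (by norm_num)

/-- `135 + 78√3 > 0`, indeed `≥ 135`. [cite: Zudilin2003WellPoised, §2 (zeros 135 ± 78√3)] -/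
theorem lam_pos : (0 : ℝ) < 135 + 78 * Real.sqrt 3 := by
  have := Real.sqrt_nonneg 3; positivity

/-- `log(135 + 78√3) = 3 log(3 + 2√3)` (`135 + 78√3 = (3 + 2√3)³`).
[cite: Zudilin2003WellPoised, §2 ("135 ± 78√3 = (3 ± 2√3)³")] -/
theorem log_lam : Real.log (135 + 78 * Real.sqrt 3) = 3 * Real.log (3 + 2 * Real.sqrt 3) := by
  obtain ⟨-, hcube, -, -⟩ := charPoly_roots (Real.sqrt 3) sqrt_three_sq
  rw [← hcube, Real.log_pow]
  norm_num

/-- `log 27 − log(135 + 78√3) = 3 log|3 − 2√3|` (`(135 + 78√3)(135 − 78√3) = −27`, `(3 − 2√3)³ = 135 − 78√3`,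
so `|3 − 2√3|³ = 27/(135 + 78√3)`). [cite: Zudilin2003WellPoised, §2 ("135 ± 78√3 = (3 ± 2√3)³")] -/
theorem log_decay :
    Real.log 27 - Real.log (135 + 78 * Real.sqrt 3) = 3 * Real.log |3 - 2 * Real.sqrt 3| := by
  have hs := sqrt_three_sq
  obtain ⟨-, -, -, hcube⟩ := charPoly_roots (Real.sqrt 3) hs
  have hl := lam_pos
  have hprod : (135 + 78 * Real.sqrt 3) * (78 * Real.sqrt 3 - 135) = 27 := by nlinarith
  have hq : (27 : ℝ) / (135 + 78 * Real.sqrt 3) = 78 * Real.sqrt 3 - 135 := by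
    rw [div_eq_iff hl.ne']; linarith
  have habs : |3 - 2 * Real.sqrt 3| ^ 3 = 78 * Real.sqrt 3 - 135 := by
    have hneg : (3 : ℝ) - 2 * Real.sqrt 3 < 0 := by nlinarith
    rw [abs_of_neg hneg, show (-(3 - 2 * Real.sqrt 3)) ^ 3 = -((3 - 2 * Real.sqrt 3) ^ 3) by ring, hcube]
    ring
  rw [← Real.log_div (by norm_num) hl.ne', hq, ← habs, Real.log_pow]
  norm_num

/-! ### Poincaré: ratio limit and growth rate for any solution bracketed below by `12` -/

/-- **Poincaré's theorem applied to (3)**: a real solution `x` of (3) (cleared form) with `x_n > 0` and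
`12x_n ≤ x_{n+1}` for `n ≥ N` has `x_{n+1}/x_n → 135 + 78√3` (contraction constant `|−27|/12² < 1`;
`135 + 78√3 ≥ 12` is the unique characteristic root `≥ 12`).
[cite: Zudilin2003WellPoised, §2 (display after Theorem 1, "Application of Poincaré's theorem")] -/
theorem tendsto_ratio_of_bracket (x : ℕ → ℝ) (N : ℕ)
    (hrec : ∀ m : ℕ, ((m : ℝ) + 2) ^ 5 * x (m + 2) = b ((m : ℝ) + 1) * x (m + 1) + c ((m : ℝ) + 1) * x m)
    (hbr : ∀ n, N ≤ n → 0 < x n ∧ 12 * x n ≤ x (n + 1)) :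
    Tendsto (fun n => x (n + 1) / x n) atTop (𝓝 (135 + 78 * Real.sqrt 3)) := by
  obtain ⟨hroot, -, -, -⟩ := charPoly_roots (Real.sqrt 3) sqrt_three_sq
  have hsolved : ∀ m, N ≤ m → x (m + 2) =
      (fun m : ℕ => b ((m : ℝ) + 1) / ((m : ℝ) + 2) ^ 5) m * x (m + 1) -
        (fun m : ℕ => -(c ((m : ℝ) + 1)) / ((m : ℝ) + 2) ^ 5) m * x m := by
    intro m _
    have hm : ((m : ℝ) + 2) ^ 5 ≠ 0 := by positivity
    have h := hrec m
    simp only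
    field_simp
    linear_combination h
  refine tendsto_ratio_of_recurrence₂ x _ _ (L := 12) (lam := 135 + 78 * Real.sqrt 3) N hsolved
    tendsto_coeffS tendsto_coeffT (by norm_num) (fun n hn => (hbr n hn).1.ne') (fun n hn => ?_) ?_ ?_ ?_
  · obtain ⟨hpos, hle⟩ := hbr n hn
    rwa [le_div_iff₀ hpos]
  · linear_combination hroot
  · linarith [Real.sqrt_nonneg 3]
  · rw [abs_neg]; norm_num

/-- **Rate from ratio** (Elaydi's Lemma 7.14): such a solution has `log x_n/n → log(135 + 78√3)` provided
`x_n > 0` for `n ≥ 1`. [cite: Zudilin2003WellPoised, §2 (display after Theorem 1)] -/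
theorem tendsto_log_div_of_bracket (x : ℕ → ℝ) (N : ℕ)
    (hrec : ∀ m : ℕ, ((m : ℝ) + 2) ^ 5 * x (m + 2) = b ((m : ℝ) + 1) * x (m + 1) + c ((m : ℝ) + 1) * x m)
    (hbr : ∀ n, N ≤ n → 0 < x n ∧ 12 * x n ≤ x (n + 1)) (hpos : ∀ n, 1 ≤ n → 0 < x n) :
    Tendsto (fun n => Real.log (x n) / n) atTop (𝓝 (Real.log (135 + 78 * Real.sqrt 3))) := by
  have h := tendsto_log_abs_div_of_tendsto_ratio x N (fun n hn => (hbr n hn).1.ne') lam_pos.ne'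
    (tendsto_ratio_of_bracket x N hrec hbr)
  rw [abs_of_pos lam_pos] at h
  refine h.congr' ?_
  filter_upwards [eventually_ge_atTop 1] with n hn
  rw [abs_of_pos (hpos n hn)]

/-! ### `coeff_asymptotics` PROVED -/

/-- The recursion (3) for `u`, cleared form over `ℝ`. [cite: Zudilin2003WellPoised, §2 eqs. (3), (5)] -/
theorem u_cast_cleared (m : ℕ) :
    ((m : ℝ) + 2) ^ 5 * (u (m + 2) : ℝ) = b ((m : ℝ) + 1) * (u (m + 1) : ℝ) + c ((m : ℝ) + 1) * (u m : ℝ) :=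
  seq_cast_cleared 1 12 m

/-- The recursion (3) for `v`, cleared form over `ℝ`. [cite: Zudilin2003WellPoised, §2 eqs. (3), (5)] -/
theorem v_cast_cleared (m : ℕ) :
    ((m : ℝ) + 2) ^ 5 * (v (m + 2) : ℝ) = b ((m : ℝ) + 1) * (v (m + 1) : ℝ) + c ((m : ℝ) + 1) * (v m : ℝ) :=
  seq_cast_cleared 0 13 m

/-- **Exact ratio limit**: `u_{n+1}/u_n → 135 + 78√3 = 270.0999…`.
[cite: Zudilin2003WellPoised, §2 (display after Theorem 1)] -/
theorem tendsto_ratio_u :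
    Tendsto (fun n => (u (n + 1) : ℝ) / (u n : ℝ)) atTop (𝓝 (135 + 78 * Real.sqrt 3)) :=
  tendsto_ratio_of_bracket (fun n => (u n : ℝ)) 0 u_cast_cleared (fun n _ => u_pos_ratio n)

/-- **`lim log u_n/n = 3 log(3 + 2√3) = 5.59879212…`** [cite: Zudilin2003WellPoised, §2 (display after Theorem 1)] -/
theorem tendsto_log_u_div :
    Tendsto (fun n : ℕ => Real.log (u n : ℝ) / n) atTop (𝓝 (3 * Real.log (3 + 2 * Real.sqrt 3))) := by
  rw [← log_lam]
  exact tendsto_log_div_of_bracket (fun n => (u n : ℝ)) 0 u_cast_cleared (fun n _ => u_pos_ratio n)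
    (fun n _ => (u_pos_ratio n).1)

/-- **Exact ratio limit for the second solution**: `v_{n+1}/v_n → 135 + 78√3`.
[cite: Zudilin2003WellPoised, §2 (display after Theorem 1)] -/
theorem tendsto_ratio_v :
    Tendsto (fun n => (v (n + 1) : ℝ) / (v n : ℝ)) atTop (𝓝 (135 + 78 * Real.sqrt 3)) :=
  tendsto_ratio_of_bracket (fun n => (v n : ℝ)) 1 v_cast_cleared v_pos_ratio

/-- **`lim log v_n/n = 3 log(3 + 2√3)`** [cite: Zudilin2003WellPoised, §2 (display after Theorem 1)] -/
theorem tendsto_log_v_div :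
    Tendsto (fun n : ℕ => Real.log (v n : ℝ) / n) atTop (𝓝 (3 * Real.log (3 + 2 * Real.sqrt 3))) := by
  rw [← log_lam]
  exact tendsto_log_div_of_bracket (fun n => (v n : ℝ)) 1 v_cast_cleared v_pos_ratio
    (fun n hn => (v_pos_ratio n hn).1)

/-- **Zudilin 2003 (JTNB), §2, first display after Theorem 1 — PROVED** (discharges the named fact
`coeff_asymptotics` of `ZetaFourRecursion.lean`): `lim log u_n/n = lim log v_n/n = 3 log(3 + 2√3)`, by
Poincaré's theorem exactly as the source says. [cite: Zudilin2003WellPoised, §2 (display after Theorem 1)] -/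
theorem coeff_asymptotics_holds : coeff_asymptotics := ⟨tendsto_log_u_div, tendsto_log_v_div⟩

/-- `u_n^{1/n} → (3 + 2√3)³ = 135 + 78√3`. [cite: Zudilin2003WellPoised, §2 (display after Theorem 1)] -/
theorem tendsto_root_u :
    Tendsto (fun n : ℕ => (u n : ℝ) ^ (1 / (n : ℝ))) atTop (𝓝 ((3 + 2 * Real.sqrt 3) ^ 3)) := by
  obtain ⟨-, hcube, -, -⟩ := charPoly_roots (Real.sqrt 3) sqrt_three_sq
  rw [hcube]
  refine Zudilin2003Growth.tendsto_root_of_tendsto_log_div (fun n => (u n : ℝ)) lam_pos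
    (fun n _ => (u_pos_ratio n).1) ?_
  rw [log_lam]
  exact tendsto_log_u_div

/-! ### The Casoratian `W_n = u_nv_{n+1} − u_{n+1}v_n` and the steps of `v_n/u_n` -/

/-- Abel, one step: `W_{m+1} = t_m W_m`, `t_m = −c(m+1)/(m+2)⁵`.
[cite: Zudilin2003WellPoised, §2 (display after Theorem 1, "[Zu1], Proposition 2")] -/
theorem casoratian_succ_eq (m : ℕ) :
    (u (m + 1) : ℝ) * v (m + 2) - u (m + 2) * v (m + 1) =
      -(c ((m : ℝ) + 1)) / ((m : ℝ) + 2) ^ 5 * ((u m : ℝ) * v (m + 1) - u (m + 1) * v m) :=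
  casoratian_succ (fun n => (u n : ℝ)) (fun n => (v n : ℝ))
    (fun m : ℕ => b ((m : ℝ) + 1) / ((m : ℝ) + 2) ^ 5)
    (fun m : ℕ => -(c ((m : ℝ) + 1)) / ((m : ℝ) + 2) ^ 5) m (seq_cast_solved 1 12 m) (seq_cast_solved 0 13 m)

/-- `W₀ = u₀v₁ − u₁v₀ = 13`. [cite: Zudilin2003WellPoised, §2 eq. (5)] -/
theorem casoratian_zero : (u 0 : ℝ) * v 1 - u 1 * v 0 = 13 := by
  simp [u, v, seq]

/-- `W_n ≠ 0` for every `n` (`t_m ≠ 0`). [cite: Zudilin2003WellPoised, §2 (display after Theorem 1)] -/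
theorem casoratian_ne_zero (n : ℕ) : (u n : ℝ) * v (n + 1) - u (n + 1) * v n ≠ 0 := by
  induction n with
  | zero => rw [casoratian_zero]; norm_num
  | succ m ih =>
    rw [show m + 1 + 1 = m + 2 by ring, casoratian_succ_eq m]
    refine mul_ne_zero (div_ne_zero ?_ (by positivity)) ih
    exact neg_ne_zero.2 (c_succ_pos m).ne'

/-- **`log|W_n|/n → log 27`** (`W_{n+1}/W_n = t_n → −27`, Elaydi's Lemma 7.14).
[cite: Zudilin2003WellPoised, §2 (display after Theorem 1)] -/
theorem tendsto_log_abs_casoratian_div :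
    Tendsto (fun n : ℕ => Real.log |(u n : ℝ) * v (n + 1) - u (n + 1) * v n| / n) atTop
      (𝓝 (Real.log 27)) := by
  have h := tendsto_log_abs_div_of_tendsto_ratio (fun n => (u n : ℝ) * v (n + 1) - u (n + 1) * v n) 0
    (fun n _ => casoratian_ne_zero n) (show (-27 : ℝ) ≠ 0 by norm_num)
    (tendsto_coeffT.congr fun n => by
      rw [show n + 1 + 1 = n + 2 by ring, casoratian_succ_eq n, mul_div_cancel_right₀ _ (casoratian_ne_zero n)])
  rw [abs_neg] at h
  simpa using h

/-- The steps of the approximants: `v_{n+1}/u_{n+1} − v_n/u_n = W_n/(u_nu_{n+1})`.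
[cite: Zudilin2003WellPoised, §2 (display after Theorem 1)] -/
theorem step_eq (n : ℕ) :
    (v (n + 1) : ℝ) / u (n + 1) - v n / u n =
      ((u n : ℝ) * v (n + 1) - u (n + 1) * v n) / ((u n : ℝ) * u (n + 1)) := by
  have h0 := ((u_pos_ratio n).1).ne'
  have h1 := ((u_pos_ratio (n + 1)).1).ne'
  field_simp

/-- The steps never vanish. [cite: Zudilin2003WellPoised, §2 (display after Theorem 1)] -/
theorem step_ne_zero (n : ℕ) : (v (n + 1) : ℝ) / u (n + 1) ≠ v n / u n := by
  intro h
  have h2 := step_eq n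
  rw [h, sub_self] at h2
  exact div_ne_zero (casoratian_ne_zero n) (mul_pos ((u_pos_ratio n).1) ((u_pos_ratio (n + 1)).1)).ne' h2.symm

/-- `d_{n+1} = d_n · t_nu_n/u_{n+2}` for the steps `d_n = v_{n+1}/u_{n+1} − v_n/u_n`.
[cite: Zudilin2003WellPoised, §2 (display after Theorem 1)] -/
theorem step_succ (n : ℕ) :
    (v (n + 2) : ℝ) / u (n + 2) - v (n + 1) / u (n + 1) =
      ((v (n + 1) : ℝ) / u (n + 1) - v n / u n) *
        (-(c ((n : ℝ) + 1)) / ((n : ℝ) + 2) ^ 5 * (u n : ℝ) / (u (n + 2) : ℝ)) := by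
  have h0 := ((u_pos_ratio n).1).ne'
  have h1 := ((u_pos_ratio (n + 1)).1).ne'
  have h2 := ((u_pos_ratio (n + 2)).1).ne'
  rw [show n + 2 = n + 1 + 1 by ring, step_eq (n + 1), step_eq n, show n + 1 + 1 = n + 2 by ring,
    casoratian_succ_eq n]
  field_simp

/-- **The contraction factor**: `|t_n| u_n/u_{n+2} ≤ 27/144 = 3/16` (`|t_n| ≤ 27`, `u_{n+2} ≥ 144u_n`).
[cite: Zudilin2003WellPoised, §2 (display after Theorem 1)] -/
theorem contraction_le (n : ℕ) :
    |-(c ((n : ℝ) + 1)) / ((n : ℝ) + 2) ^ 5| * (u n : ℝ) / (u (n + 2) : ℝ) ≤ 3 / 16 := by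
  have hu0 := (u_pos_ratio n).1
  have hu2 := (u_pos_ratio (n + 2)).1
  have hm : (0 : ℝ) < ((n : ℝ) + 2) ^ 5 := by positivity
  have ht : |-(c ((n : ℝ) + 1)) / ((n : ℝ) + 2) ^ 5| ≤ 27 := by
    rw [abs_div, abs_neg, abs_of_pos (c_succ_pos n), abs_of_pos hm, div_le_iff₀ hm]
    exact c_succ_le n
  have hg1 := (u_pos_ratio n).2
  have hg2 := (u_pos_ratio (n + 1)).2
  rw [show n + 1 + 1 = n + 2 by ring] at hg2
  have hu2' : 144 * (u n : ℝ) ≤ u (n + 2) := by linarith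
  rw [div_le_iff₀ hu2]
  nlinarith [abs_nonneg (-(c ((n : ℝ) + 1)) / ((n : ℝ) + 2) ^ 5)]

/-- **Geometric shrinking of the steps**: `|d_{k+1}| ≤ (3/16)|d_k|` for all `k`.
[cite: Zudilin2003WellPoised, §2 (display after Theorem 1)] -/
theorem abs_step_succ_le (k : ℕ) (_hk : 0 ≤ k) :
    |(v (k + 2) : ℝ) / u (k + 2) - v (k + 1) / u (k + 1)| ≤
      3 / 16 * |(v (k + 1) : ℝ) / u (k + 1) - v k / u k| := by
  rw [step_succ k, abs_mul, mul_comm]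
  refine mul_le_mul_of_nonneg_right ?_ (abs_nonneg _)
  rw [abs_div, abs_mul, abs_of_pos ((u_pos_ratio k).1), abs_of_pos ((u_pos_ratio (k + 2)).1)]
  exact contraction_le k

/-- **The approximants converge**: `v_n/u_n → L` for some real `L` (geometric steps). The identification
`L = ζ(4)` is Theorem 1 (7), not proved here. [cite: Zudilin2003WellPoised, Theorem 1 (7)] -/
theorem exists_tendsto_ratio : ∃ L : ℝ, Tendsto (fun n : ℕ => (v n : ℝ) / u n) atTop (𝓝 L) := by
  have hgeo : ∀ n : ℕ, dist ((v n : ℝ) / u n) ((v (n + 1) : ℝ) / u (n + 1)) ≤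
      |(v 1 : ℝ) / u 1 - v 0 / u 0| * (3 / 16) ^ n := by
    intro n
    have h := TailSqueeze.abs_step_add_le (fun n : ℕ => (v n : ℝ) / u n) 0 (θ := 3 / 16) (by norm_num)
      abs_step_succ_le 0 le_rfl n
    simp only [zero_add] at h
    rw [dist_comm, Real.dist_eq]
    linarith
  exact cauchySeq_tendsto_of_complete (cauchySeq_of_le_geometric (3 / 16) _ (by norm_num) hgeo)

/-! ### Exact rates of the steps and of the forms `u_nL − v_n` -/

/-- `log u_{n+1}/n → log(135 + 78√3)`. [cite: Zudilin2003WellPoised, §2 (display after Theorem 1)] -/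
theorem tendsto_log_u_succ_div :
    Tendsto (fun n : ℕ => Real.log (u (n + 1) : ℝ) / n) atTop (𝓝 (Real.log (135 + 78 * Real.sqrt 3))) := by
  have h1 : Tendsto (fun n : ℕ => Real.log ((u (n + 1) : ℝ) / u n)) atTop
      (𝓝 (Real.log (135 + 78 * Real.sqrt 3))) := tendsto_ratio_u.log lam_pos.ne'
  have h2 : Tendsto (fun n : ℕ => Real.log ((u (n + 1) : ℝ) / u n) / n) atTop (𝓝 0) :=
    h1.div_atTop tendsto_natCast_atTop_atTop
  have h0 : Tendsto (fun n : ℕ => Real.log (u n : ℝ) / n) atTop (𝓝 (Real.log (135 + 78 * Real.sqrt 3))) := by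
    rw [log_lam]; exact tendsto_log_u_div
  have h3 := h0.add h2
  rw [add_zero] at h3
  refine h3.congr fun n => ?_
  have hu0 := (u_pos_ratio n).1
  have hu1 := (u_pos_ratio (n + 1)).1
  rw [← add_div, Real.log_div hu1.ne' hu0.ne']
  ring

/-- **Exact rate of the steps**: `log|v_{n+1}/u_{n+1} − v_n/u_n|/n → log 27 − 2 log(135 + 78√3)`.
[cite: Zudilin2003WellPoised, §2 (display after Theorem 1)] -/
theorem tendsto_log_abs_step_div :
    Tendsto (fun n : ℕ => Real.log |(v (n + 1) : ℝ) / u (n + 1) - v n / u n| / n) atTop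
      (𝓝 (Real.log 27 - 2 * Real.log (135 + 78 * Real.sqrt 3))) := by
  have h0 : Tendsto (fun n : ℕ => Real.log (u n : ℝ) / n) atTop (𝓝 (Real.log (135 + 78 * Real.sqrt 3))) := by
    rw [log_lam]; exact tendsto_log_u_div
  have h := (tendsto_log_abs_casoratian_div.sub h0).sub tendsto_log_u_succ_div
  have e : Real.log 27 - Real.log (135 + 78 * Real.sqrt 3) - Real.log (135 + 78 * Real.sqrt 3) =
      Real.log 27 - 2 * Real.log (135 + 78 * Real.sqrt 3) := by ring
  rw [e] at h
  refine h.congr fun n => ?_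
  have hu0 := (u_pos_ratio n).1
  have hu1 := (u_pos_ratio (n + 1)).1
  have hW := abs_pos.2 (casoratian_ne_zero n)
  rw [step_eq n, abs_div, abs_mul, abs_of_pos hu0, abs_of_pos hu1,
    Real.log_div hW.ne' (mul_pos hu0 hu1).ne', Real.log_mul hu0.ne' hu1.ne']
  ring

variable {L : ℝ}

/-- **Non-vanishing**: if `v_n/u_n → L` then `u_nL − v_n ≠ 0` for EVERY `n` (tail squeeze with `θ = 3/16 < ½`).
[cite: Zudilin2003WellPoised, §2 (display after Theorem 1, "[Zu1], Proposition 2")] -/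
theorem form_ne_zero_of_tendsto (hL : Tendsto (fun n : ℕ => (v n : ℝ) / u n) atTop (𝓝 L)) (n : ℕ) :
    (u n : ℝ) * L - v n ≠ 0 := by
  have h := TailSqueeze.lim_sub_ne_zero (fun n : ℕ => (v n : ℝ) / u n) 0 (θ := 3 / 16) (by norm_num)
    (by norm_num) hL abs_step_succ_le n (Nat.zero_le n) (step_ne_zero n)
  have hu := ((u_pos_ratio n).1).ne'
  intro h0
  apply h
  field_simp
  linarith

/-- **Exact approximation rate**: if `v_n/u_n → L` then `log|L − v_n/u_n|/n → log 27 − 2 log(135 + 78√3)`.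
[cite: Zudilin2003WellPoised, §2 (display after Theorem 1, "[Zu1], Proposition 2")] -/
theorem tendsto_log_abs_sub_div_of_tendsto (hL : Tendsto (fun n : ℕ => (v n : ℝ) / u n) atTop (𝓝 L)) :
    Tendsto (fun n : ℕ => Real.log |L - (v n : ℝ) / u n| / n) atTop
      (𝓝 (Real.log 27 - 2 * Real.log (135 + 78 * Real.sqrt 3))) :=
  TailSqueeze.tendsto_log_abs_lim_sub_div (fun n : ℕ => (v n : ℝ) / u n) 0 (θ := 3 / 16) (by norm_num)
    (by norm_num) hL abs_step_succ_le (fun k _ => step_ne_zero k) tendsto_log_abs_step_div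

/-- **Exact decay of the forms at the limit**: if `v_n/u_n → L` then
`log|u_nL − v_n|/n → log 27 − log(135 + 78√3) = 3 log|3 − 2√3| = −2.30295525…`.
[cite: Zudilin2003WellPoised, §2 (display after Theorem 1, "[Zu1], Proposition 2")] -/
theorem tendsto_log_abs_form_div_of_tendsto (hL : Tendsto (fun n : ℕ => (v n : ℝ) / u n) atTop (𝓝 L)) :
    Tendsto (fun n : ℕ => Real.log |(u n : ℝ) * L - v n| / n) atTop
      (𝓝 (3 * Real.log |3 - 2 * Real.sqrt 3|)) := by
  have h0 : Tendsto (fun n : ℕ => Real.log (u n : ℝ) / n) atTop (𝓝 (Real.log (135 + 78 * Real.sqrt 3))) := by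
    rw [log_lam]; exact tendsto_log_u_div
  have h := h0.add (tendsto_log_abs_sub_div_of_tendsto hL)
  have e : Real.log (135 + 78 * Real.sqrt 3) + (Real.log 27 - 2 * Real.log (135 + 78 * Real.sqrt 3)) =
      3 * Real.log |3 - 2 * Real.sqrt 3| := by rw [← log_decay]; ring
  rw [e] at h
  refine h.congr fun n => ?_
  have hu := (u_pos_ratio n).1
  have hid : (u n : ℝ) * L - v n = u n * (L - v n / u n) := by field_simp
  by_cases hz : L - (v n : ℝ) / u n = 0
  · exfalso; exact form_ne_zero_of_tendsto hL n (by rw [hid, hz, mul_zero])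
  · rw [hid, abs_mul, abs_of_pos hu, Real.log_mul hu.ne' (abs_ne_zero.2 hz), add_div]

/-- **Unconditional summary**: `v_n/u_n` converges to some `L`, and for that `L`: `u_nL − v_n ≠ 0` for all `n`
and `log|u_nL − v_n|/n → 3 log|3 − 2√3|`. (The source's `L = ζ(4)` is Theorem 1 (7), cited in
`ZetaFourRecursion.lean`.) [cite: Zudilin2003WellPoised, §2 (display after Theorem 1)] -/
theorem exists_limit_rates :
    ∃ L : ℝ, Tendsto (fun n : ℕ => (v n : ℝ) / u n) atTop (𝓝 L) ∧ (∀ n, (u n : ℝ) * L - v n ≠ 0) ∧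
      Tendsto (fun n : ℕ => Real.log |(u n : ℝ) * L - v n| / n) atTop
        (𝓝 (3 * Real.log |3 - 2 * Real.sqrt 3|)) := by
  obtain ⟨L, hL⟩ := exists_tendsto_ratio
  exact ⟨L, hL, form_ne_zero_of_tendsto hL, tendsto_log_abs_form_div_of_tendsto hL⟩

/-- **`form_asymptotics` from the limit relation (7)**: if `v_n/u_n → ζ(4)` then
`lim log|u_nζ(4) − v_n|/n = 3 log|3 − 2√3|` — the source's "(see [Zu1], Proposition 2)".
[cite: Zudilin2003WellPoised, §2 (display after Theorem 1)] -/
theorem form_asymptotics_of_tendsto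
    (hζ : Tendsto (fun n : ℕ => (v n : ℝ) / u n) atTop (𝓝 (zetaValue 4))) : form_asymptotics :=
  tendsto_log_abs_form_div_of_tendsto hζ

/-- **`theorem1_limit → form_asymptotics`**: the second display after Theorem 1 is a COROLLARY of (7).
[cite: Zudilin2003WellPoised, §2 (display after Theorem 1) and Theorem 1 (7)] -/
theorem form_asymptotics_of_theorem1_limit (h : theorem1_limit) : form_asymptotics := by
  refine form_asymptotics_of_tendsto (h.congr fun n => ?_)
  push_cast
  rfl

end Literature.NumberTheory.Irrationality.Zudilin2003.ZetaFour

end
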